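import Literature.MathematicalPhysics.QuantumFieldTheory.Balaban1983to89.B9Eq370Expansion

/-!
# `Balaban1983to89.B9Eq371Composition` — B9, pp. 404–405, display (3.71): the COMPOSITION of the two expansions (3.70)/(3.74),
# `D*_{U′U}D_{U′U}A′ = D*_U D_U A′ − V₁(A)A′`, with the print's five-term and seven-term first-order brackets VERBATIM, the
# higher-order operator `F_{1,k}(A)` made EXPLICIT, and the bounds (3.72), (3.73) with every `O(1)` explicit; kernel-checked; v1

CITATION HEADER (lean-in-tree rule).  Audit cell `pub-balaban`, surge node-prover lineage pv27 (B9 pp. 390–392, 396–397, 404–405),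
unit `b2b-balaban-pv27-g18` (journal CLAIM l.55916, node B9-EQ371-COMPOSITION; third node of the seat, after B9-EQ369-PRODUCT =
`B9Eq369Product` (p189850, v1.1 p190342) and B9-EQ370-EXPANSION = `B9Eq370Expansion` (p190151, v1.1 p190343)).  Source: T. Bałaban,
*Propagators for lattice gauge theories in a background field*, Commun. Math. Phys. **99** (1985) 389–434
[Balaban1985BackgroundPropagators] (cell paper B9; journal page = PDF page + 388), p. 404 [PDF 16] (display (3.71), first three
expressions) and p. 405 [PDF 17] (end of (3.71), the `F_{1,k}` sentence, (3.72), (3.73)), with (3.37) p. 396 [PDF 8] and (3.39) p. 397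
[PDF 9], quoted from the page renders `b2b-balaban-ref1/pages/1985-cmp99-background-propagators/…-p016-x2.png`, `…-p017-x2.png` READ AS
IMAGES by this seat (2026-08-19, 2× crops of the (3.71) lines).  The full verbatim transcription of the passage (3.70)–(3.74) with its
[sic] marks is in the header of `B9Eq370Expansion` (the single import); (3.2)–(3.12) are quoted in `B9Eq37Insertion`/`B9Eq39Adjoint`/
`B9Eq310Hermitian`, (3.35)/(3.37)/(3.39) in `B9Eq369Small` — all imported BY NAME, transitively.

HONEST FRAMING (cell charter, verbatim in substance).  The cell audits Bałaban's papers; discharging its end statements would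
make Bałaban's ultraviolet stability theorem unconditional inside this package — a constructive-QFT statement; it is NOT the
continuum limit and NOT the Clay problem.  THIS FILE DISCHARGES NOTHING of the series: it is non-commutative bookkeeping — the
composition of two first-order expansions of conjugations in a Banach algebra and the triangle inequality — on the lineage's lattice
carrier (`B9Eq39Adjoint`: `R W X = WXW⁻¹`, `covD`, `covDstar`, `curl`, `divP`, `prodCfg U η A = (b ↦ e^{iηA(b)}·U(b))`), consuming BY
NAME the per-transport identities and remainder bounds of `B9Eq370Expansion` (`covD_prodCfg_expand`, `covDstar_prodCfg_expand`,
`conjRem`, `norm_conjRem_le_sq`, `norm_R_le`, `R_Iη_smul`, `norm_Iη_smul`) and the commutator `ad` of `Beta.BackgroundVertices`.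
Value = kernel certificate that (3.71) is an IDENTITY on the abstract carrier (arbitrary units `U(b)`, arbitrary bijections as shifts,
no commutativity, no `‖1‖ = 1`) with the print's two first-order brackets letter for letter — in particular the print's REGROUPING
(middle expression ⟶ last expression of (3.71)) is EXACT, term by term in `ν` (`tBracket_eq_sBracket`) — once the higher-order
operator `F_{1,k}(A)`, which the print defines only as «the remainder of the expansion», is given the explicit closed form `F₁op`
below; and that (3.72)/(3.73) hold with explicit constants under uniform sup hypotheses.  NOT summit progress.

ABSOLUTE RULE.  No internally-minted statement enters as a cited fact.  Every declaration below is PROVED (tags `[folklore]`);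
the `[cite: …]` tags document WHICH PRINTED DISPLAY a definition or a proved statement transcribes — the proofs are ours, the
print is not used as a hypothesis anywhere.  The regularity input (3.37) enters the two `_printed` corollaries as HYPOTHESES on the
letters (`‖A(b)‖ ≤ a ≤ α₁(L^jη)⁻¹`, `‖(D¹A)(b)‖ ≤ g ≤ η·α₁(L^jη)⁻²`) with `α₁`, `L ≥ 1`, `η > 0`, `j` as binders.

LETTERS AND NORMALISATION (as `B9Eq370Expansion`).  p. 404–405 RENAME the letters of (3.37): the exponent field of `U′ = e^{iηA}` is
`A`, and `A′` is the ARGUMENT the operators act on; `prodCfg U η A = U′U`.  `D¹_ν := covD = η·D_ν`, `D¹*_ν := covDstar = η·D*_ν`,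
`(D¹A′)_{νμ} := curl A′ ν μ = D¹_νA′_μ − D¹_μA′_ν = η·(DA′)_{νμ}` (component formula after (3.4)); the print's `iad_{A}` with its
factor `η` is `ad (iη·A)` (`ad b Z = bZ − Zb`).  Hence every object of this file is `η²` × the printed one: `lapDD = η²·(D*DA′)_μ(x)`,
`tBracket_ν = η·[five-term bracket]_ν` (the print's middle bracket carries one `η` inside and `η⁻¹` outside), `sBracket_ν = η²·[seven-
term bracket]_ν`, `F₁op = η²·(F_{1,k}(A)A′)_μ(x)`, `V₁op = η²·(V₁(A)A′)_μ(x)`.  Geometry through (3.5): `x + e_ν = T ν x`, `y := x − e_ν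
= (T ν).symm x`, `U(x, x+e_ν) = U_ν(x)`, `U(x, x−e_ν) = U_ν(y)⁻¹`, `U(x−e_ν, x−e_ν+e_μ) = U_μ(y)`.

WHAT IS IN PRINT (p. 404 [PDF 16] bottom – p. 405 [PDF 17] top; «…» verbatim, transcribed in full in `B9Eq370Expansion`'s header):
(3.71) is ONE display with FOUR expressions: «(D*_{U′U}D_{U′U}A′)_μ(x) = Σ_{ν=1}^d η⁻¹(R((U′U)(x, x − ηe_ν))(D_{U′U}A′)(x − ηe_ν) −
(D_{U′U}A′)(x))» [first] «= (D*_U D_U A′)_μ(x) − η⁻¹ Σ_{ν=1}^d [ηR(U(x, x − ηe_ν))iad_{A_ν(x−ηe_ν)}(D_U A′)_{νμ}(x − ηe_ν) − R(U(x, x −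
ηe_ν))iad_{A_ν(x−ηe_ν)}R(U(x − ηe_ν, x))A′_μ(x) + R(U(x, x − ηe_ν))iad_{A_μ(x−ηe_ν)}R(U(x − ηe_ν, x − ηe_ν + ηe_μ))·A′_ν(x − ηe_ν + ηe_μ)
+ iad_{A_ν(x)}R(U(x, x + ηe_ν))A′_μ(x + ηe_ν) − iad_{A_μ(x)}R(U(x, x + ηe_μ))A′_ν(x + ηe_μ)] − (F_{1,k}(A)A′)_μ(x)» [middle: the
FIVE-TERM bracket] «= (D*DA′)_μ(x) − Σ_{ν=1}^d [R(U(x, x − ηe_ν))iad_{A_ν(x−ηe_ν)}(DA′)_{νμ}(x − ηe_ν) − iad_{(D*_νA_ν)(x)}A′_μ(x) + R(U(x,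
x − ηe_ν))iad_{A_μ(x−ηe_ν)}(D_μA′_ν)(x − ηe_ν) + iad_{A_ν(x)}(D_νA′_μ)(x) − iad_{A_μ(x)}(D_μA′_ν)(x) + iad_{(D*_νA_μ)(x)}R(U(x, x −
ηe_ν))A′_ν(x − ηe_ν) + iad_{A_μ(x)}(D*_νA′_ν)(x)] − (F_{1,k}(A)A′)_μ(x)» [penultimate: the SEVEN-TERM bracket] «= (D*DA′)_μ(x) −
(V₁(A)A′)_μ(x). (3.71)» [last: DEFINES `V₁(A)`].  Then: «The operator F_{1,k} is defined similarly to F′_{1,k} by taking the remainder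
of the expansion R(U′) = exp ηiad_A = 1 + ηiad_A + ⋯ in the expressions above. It is a local, bounded operator satisfying the bound
|(F_{1,k}(A)A′)_μ(x)| ≤ O(1)|A|²|A′| ≤ O(1)α₁²(L^jη)⁻²|A′|, b ∈ Ω_j (3.72) with the same norms |A|, |A′| determined by the set st(b) as
in (3.69). The operator V₁ satisfies |(V₁(A)A′)(b)| ≤ O(1)(|A||∇A′| + |∇A||A′| + |A|²|A′|) ≤ O(1)α₁((L^jη)⁻¹|∇A′| + (L^jη)⁻²|A′|), b ∈
Ω_j, (3.73) with the same conditions on norms as above. The derivatives are, of course, the covariant derivatives defined by U. The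
constant O(1) is an absolute constant depending on d only.»  (3.39), p. 397: «|A| = max_μ sup_x |A_μ(x)|, |∇A| = max_{μ,ν} sup_x
|(D_μA_ν)(x)|»; (3.37), p. 396: «|A′| < α₁(L^jη)⁻¹, |∇^η_U A′| < α₁(L^jη)⁻² on Ω_j».  READING FIXED BY THE PRINT: since the last
equality has no separate `F` term, `(V₁(A)A′)_μ(x) := Σ_ν[seven-term bracket]_ν + (F_{1,k}(A)A′)_μ(x)` — `V₁` collects the first AND
the higher orders in `A` (whence the `|A|²|A′|` in (3.73)); `V₁op` below is typed exactly so.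

WHAT THIS FILE PROVES.  MODEL (as in the lineage leaves): `𝔸` a complete normed ℂ-algebra; sites `S`, directions `ι` (`Fintype` where
`Σ_ν` occurs), shifts `T ν : S ≃ S` (NO commutation assumed), background `U : ι → S → 𝔸ˣ` (ARBITRARY units), exponent field `A`, argument
`A′ : ι → S → 𝔸`; norms = the `NormedRing` norm.
* §1 ALGEBRA: **`R_ad`** `R(V)[b, Z] = [R(V)b, R(V)Z]` — the regrouping step «R(U(x,x−ηe_ν))iad_{A_ν(x−ηe_ν)}R(U(x−ηe_ν,x)) ⟶
  iad_{R(U(x,x−ηe_ν))A_ν(x−ηe_ν)}» behind the passage middle ⟶ last expression; monotone norm forms `norm_R_le_sq` (`‖R(V)Z‖ ≤ ρ²‖Z‖`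
  for `‖V‖, ‖V⁻¹‖ ≤ ρ`), `norm_ad_le_of_le` (`≤ 2s‖X‖`), `norm_conjRem_le_of_le` (`≤ 2s²e^{2s}‖X‖`).
* §2 OBJECTS: `lapDD` (first expression of (3.71), any configuration in the slot of `U`); `curlE₁`, `curlE₂` (first-order and remainder
  parts of `D¹_{U′U}A′ − D¹_UA′`, from (3.70)); **`tBracket`** = the FIVE-TERM bracket, **`sBracket`** = the SEVEN-TERM bracket, letters
  verbatim (docstrings); **`fRem`**, **`F₁op = −Σ_ν fRem_ν`** — the EXPLICIT `F_{1,k}(A)A′`: per direction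
  `D¹*_{U,ν}(E₂)(x) − [a_ν, R(U(x,x−e_ν))(E₁ + E₂)(x−e_ν)] + 𝓕(−a_ν, R(U(x,x−e_ν))(D¹_{U′U}A′)_{νμ}(x−e_ν))`, `a_ν = iηR(U(x,x−e_ν))A_ν(x−e_ν)`,
  `𝓕 = conjRem` (every summand a product of ≥ 2 expansion letters); **`V₁op = Σ_ν sBracket_ν + F₁op`** (the print's `V₁(A)A′`).
* §3 (3.71) AS KERNEL IDENTITIES: `curl_prodCfg_expand` ((3.70) for the curl, split by order); **`covDstar_curl_prodCfg`** — first ⟶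
  middle expression PER DIRECTION `ν`: `D¹*_{U′U,ν}(D¹_{U′U}A′)_{νμ}(x) = D¹*_{U,ν}(D¹_UA′)_{νμ}(x) − tBracket_ν(x) + fRem_ν(x)`;
  `lapDD_prodCfg_eq_tBracket` (summed: `= lapDD − Σ_ν tBracket_ν − F₁op`); **`tBracket_eq_sBracket`** — middle ⟶ penultimate expression,
  EXACTLY and per direction (the print's regrouping moves nothing into `F_{1,k}`, consistently with the same `F_{1,k}` appearing in both);
  `lapDD_prodCfg_eq_sBracket`; **`lapDD_prodCfg`** — (3.71): `lapDD T (prodCfg U η A) A′ μ x = lapDD T U A′ μ x − V₁op T U η A A′ μ x`;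
  `lapDD_eq_divP_curl` (the first expression IS `D*(DA′)` of (3.9): `B9Eq39Adjoint.divP_eq_sum_of_antisymm`, `curl_swap`, `curl_self` BY NAME),
  `covDstar_eq_neg_R_covD` (`D¹*_ν = −R(U(x,x−e_ν))∘D¹_ν∘shift`, (3.8) with (3.5): converts the print's `|∇A|` (FORWARD derivatives, (3.39))
  into bounds on `D¹*A`).
* §4 THE BOUNDS, `O(1)` EXPLICIT, under UNIFORM sups `‖A_κ(z)‖ ≤ a`, `‖A′_κ(z)‖ ≤ a′`, `‖(D¹_κA_τ)(z)‖ ≤ g`, `‖(D¹_κA′_τ)(z)‖ ≤ g′` (all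
  `κ, τ, z` — in place of the sups over `st(b)`) and TRANSPORT SIZE `‖U(b)‖, ‖U(b)⁻¹‖ ≤ ρ`, `ρ ≥ 1` (`ρ = 1`: a `G`-valued background in an
  operator norm); `s := ηρ²a`, `d := |ι|`:  `norm_curlE₁_le`, `norm_curlE₂_le`, `norm_covD_le_of`, `norm_curl_le_of`, `norm_curl_prodCfg_le`
  (letter-level, abstract sizes); `norm_fRem_le_of` (abstract sizes) and **`norm_fRem_le`**: `‖fRem_ν(x)‖ ≤ 8ρ⁴s²e^{2s}(3 + 2s + s²e^{2s})·a′`;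
  **`norm_F₁op_le`** — (3.72), first inequality: `‖(F₁(A)A′)_μ(x)‖ ≤ d·8ρ⁴s²e^{2s}(3 + 2s + s²e^{2s})·a′` (= `η²·O(1)|A|²|A′|`, `O(1) =
  8dρ⁸e^{2s}(3 + 2s + s²e^{2s})`); **`norm_F₁op_le_printed`** — (3.72), second inequality at `ρ = 1` under (3.37): `≤ d·8e^{2α₁}(3 + 2α₁ +
  α₁²e^{2α₁})·α₁²·L^{−2j}·a′` (= `η²·O(1)α₁²(L^jη)⁻²|A′|`); `norm_sBracket_le` (`‖sBracket_ν(x)‖ ≤ η((8ρ² + 4)ag′ + 2ρ²(1 + ρ²)ga′)`),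
  `norm_sum_sBracket_le`, `norm_sum_sBracket_le_printed` (first-order part: `≤ 4dα₁(3L^{−j}g′ + L^{−2j}a′)`); **`norm_V₁op_le`** — (3.73),
  first inequality, all three printed terms: `‖(V₁(A)A′)_μ(x)‖ ≤ d·[η((8ρ² + 4)ag′ + 2ρ²(1 + ρ²)ga′) + 8ρ⁴s²e^{2s}(3 + 2s + s²e^{2s})a′]`;
  **`norm_V₁op_le_printed`** — (3.73), second inequality at `ρ = 1` under (3.37): `≤ d·α₁·[12L^{−j}g′ + (4 + 8α₁e^{2α₁}(3 + 2α₁ +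
  α₁²e^{2α₁}))L^{−2j}a′]` (= `η²·O(1)α₁((L^jη)⁻¹|∇A′| + (L^jη)⁻²|A′|)` with `g′ = η|∇A′|`; for `α₁ ≤ 1` the bracket's constants are absolute,
  «depending on d only» through the factor `d`).
* §5 SANITY (`example`s): `A = 0 ⟹ sBracket = fRem = V₁op = 0` and `lapDD(U′U) = lapDD(U)` (`prodCfg_zero`); over a COMMUTATIVE carrier
  `sBracket ≡ 0` (the first-order operator is a sum of commutators — the content is genuinely non-abelian).

RELATED IN THE TREE, NOT DUPLICATED (searched 2026-08-19: MODULE-MAP rows B9/B12/Beta; `grep -rn "(3.71)\|(3.72)\|(3.73)\|V₁(A)\|F_{1,k}"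
Balaban1983to89/` — hits only in NOT-PROVED lists and in `B9Eq370Expansion`'s quotation): `B9Eq370Expansion` (this lineage) = (3.70)/(3.74)
per transport, consumed here BY NAME; `Beta.BackgroundVertices.V₁` (β sub-cell) is a DIFFERENT object — the first `t`-jet of `covD` along
`exp(tηA)` at the UNIT background (an infinitesimal vertex), not B9's operator `V₁(A)` at an arbitrary background with its `D*`-letters and
`F_{1,k}` — only its `ad`, `ad_*` lemmas and `norm_ad_le` are used, BY NAME; `B9Eq310Hermitian.deltaOp = divPη ∘ curlη + Δ′` is (3.10), whose
`D*D` is the `η`-scaled form of `lapDD` (`lapDD_eq_divP_curl`; not restated); `B9Eq369Product`/`B9Eq369Small` = (3.69) for `Δ′`.  Nothing in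
the tree states (3.71), types `V₁(A)`/`F_{1,k}(A)` of B9, or proves (3.72)/(3.73).

NOT PROVED HERE, NOT CLAIMED: the LOCALITY clause («a local, bounded operator», norms «determined by the set st(b)», `b ∈ Ω_j`) — the
bounds are typed with UNIFORM sups over all bonds and the scale-`j` constants as binders, no `Ω_j`/`st(b)` geometry (reading off which
letters `A(b′)`, `b′ ∈ st(b)`, enter `fRem_ν(x)`/`sBracket_ν(x)` is immediate from the closed forms but not formalised); the print's
identification of the conjugation `R(e^{iηA})` with the power series `exp(ηiad_A)` (typed, as in `B9Eq370Expansion`, as the conjugation and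
its explicit remainder `conjRem`; `Ad∘exp = exp∘ad` is not formalised and not needed); uniqueness of the splitting «first order + remainder»
(the print fixes `F_{1,k}` only up to the words «taking the remainder … in the expressions above»; `F₁op` is ONE closed form making (3.71) an
identity with the printed brackets, and it is `O(|A|²|A′|)` as (3.72) demands); (3.75)/(3.76) (`DRD*`, `V₂`, `F_{2,k}`, `P₁`) and everything
after; any statement in the normalised Hilbert–Schmidt norm of p. 392 (cell DIVERGENCE D-1: all bounds are in the abstract `NormedRing` norm;
a unitary `G`-valued background is the case `ρ = 1`).  Records: GAPS C-pv27-73, DIVERGENCE D-pv27.9 (modelling divergences only: uniform sups,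
transport size `ρ`, `V₁ ⊇ F_{1,k}` reading as printed; NO print slip found in (3.71)–(3.73) — the kernel confirms both first-order brackets).
NOT summit progress.
-/

noncomputable section

namespace Literature.MathematicalPhysics.QuantumFieldTheory.Balaban1983to89.B9Eq371Composition

open NormedSpace Complex
open Literature.MathematicalPhysics.QuantumFieldTheory.Balaban1983to89
open Literature.MathematicalPhysics.QuantumFieldTheory.Balaban1983to89.Beta.TransportVertices
open Literature.MathematicalPhysics.QuantumFieldTheory.Balaban1983to89.Beta.BackgroundVertices
  (ad ad_apply norm_ad_le ad_add_left ad_add_right ad_sub_left ad_sub_right ad_neg_left ad_smul_left)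
open Literature.MathematicalPhysics.QuantumFieldTheory.Balaban1983to89.B9Eq37Insertion
open Literature.MathematicalPhysics.QuantumFieldTheory.Balaban1983to89.B9Eq39Adjoint
open Literature.MathematicalPhysics.QuantumFieldTheory.Balaban1983to89.B9Eq369Product
open Literature.MathematicalPhysics.QuantumFieldTheory.Balaban1983to89.B9Eq370Expansion

/-! ## §1  Algebra of the regrouping step: transport of a commutator, and three monotone norm bounds -/

section Algebra

variable {𝔸 : Type*} [NormedRing 𝔸] [NormedAlgebra ℂ 𝔸]

omit [NormedAlgebra ℂ 𝔸] in
/-- THE REGROUPING STEP of p. 404–405: `R(V)[b, Z] = [R(V)b, R(V)Z]` — in print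
`R(U(x, x−ηe_ν))iad_{A(x−ηe_ν)}R(U(x−ηe_ν, x)) = iad_{R(U(x,x−ηe_ν))A(x−ηe_ν)}` (transport is an algebra automorphism). [folklore]
[cite: Balaban1985BackgroundPropagators, (3.71) p.404] -/
theorem R_ad (V : 𝔸ˣ) (b Z : 𝔸) : R V (ad b Z) = ad (R V b) (R V Z) := by
  rw [ad_apply, ad_apply, R_sub, R_mul_R, R_mul_R]

omit [NormedAlgebra ℂ 𝔸] in
/-- Transport size: `‖R(V)Z‖ ≤ ρ²‖Z‖` when `‖V‖, ‖V⁻¹‖ ≤ ρ` (`= ‖Z‖`-sized for a unitary `V` in an operator norm). [folklore] -/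
theorem norm_R_le_sq (V : 𝔸ˣ) {ρ : ℝ} (h1 : ‖(V : 𝔸)‖ ≤ ρ) (h2 : ‖((V⁻¹ : 𝔸ˣ) : 𝔸)‖ ≤ ρ) (Z : 𝔸) :
    ‖R V Z‖ ≤ ρ ^ 2 * ‖Z‖ := by
  have hρ : 0 ≤ ρ := (norm_nonneg _).trans h1
  calc ‖R V Z‖ ≤ ‖(V : 𝔸)‖ * ‖Z‖ * ‖((V⁻¹ : 𝔸ˣ) : 𝔸)‖ := norm_R_le V Z
    _ ≤ ρ * ‖Z‖ * ρ :=
        mul_le_mul (mul_le_mul_of_nonneg_right h1 (norm_nonneg Z)) h2 (norm_nonneg _) (mul_nonneg hρ (norm_nonneg Z))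
    _ = ρ ^ 2 * ‖Z‖ := by ring

omit [NormedAlgebra ℂ 𝔸] in
/-- `‖[b, X]‖ ≤ 2s‖X‖` for `‖b‖ ≤ s` (`norm_ad_le`, monotone form). [folklore] -/
theorem norm_ad_le_of_le {b : 𝔸} {s : ℝ} (hb : ‖b‖ ≤ s) (X : 𝔸) : ‖ad b X‖ ≤ 2 * s * ‖X‖ := by
  calc ‖ad b X‖ ≤ 2 * ‖b‖ * ‖X‖ := norm_ad_le b X
    _ ≤ 2 * s * ‖X‖ := by gcongr

variable [CompleteSpace 𝔸]

/-- `‖𝓕(b, X)‖ ≤ 2s²e^{2s}‖X‖` for `‖b‖ ≤ s` (`norm_conjRem_le_sq`, monotone form). [folklore]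
[cite: Balaban1985BackgroundPropagators, (3.72) p.405] -/
theorem norm_conjRem_le_of_le {b : 𝔸} {s : ℝ} (hb : ‖b‖ ≤ s) (X : 𝔸) :
    ‖conjRem b X‖ ≤ 2 * s ^ 2 * Real.exp (2 * s) * ‖X‖ := by
  calc ‖conjRem b X‖ ≤ 2 * ‖b‖ ^ 2 * Real.exp (2 * ‖b‖) * ‖X‖ := norm_conjRem_le_sq b X
    _ ≤ 2 * s ^ 2 * Real.exp (2 * s) * ‖X‖ := by gcongr

end Algebra

/-! ## §2  The objects of (3.71) on the carrier (`η²`-normalisation: `D¹ = ηD`, `D¹* = ηD*`, the expansion parameter `iη` inside `ad`) -/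

section Objects

variable {𝔸 : Type*} [NormedRing 𝔸] [NormedAlgebra ℂ 𝔸] [CompleteSpace 𝔸] {S : Type*} {ι : Type*}
variable (T : ι → Equiv.Perm S) (U : ι → S → 𝔸ˣ)

/-- `(D¹*D¹A′)_μ(x) = Σ_ν (D¹*_ν (D¹A′)_{ν μ})(x)` — the FIRST LINE of (3.71), «(D*_{U′U}D_{U′U}A′)_μ(x) = Σ_{ν=1}^d η⁻¹(R((U′U)(x, x −
ηe_ν))(D_{U′U}A′)(x − ηe_ν) − (D_{U′U}A′)(x))», for ANY configuration in the slot of `U` (`= divP ∘ curl` of (3.9), `lapDD_eq_divP_curl`).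
[folklore] [cite: Balaban1985BackgroundPropagators, (3.71) p.404, (3.9) p.392] -/
def lapDD [Fintype ι] (A' : ι → S → 𝔸) (μ : ι) (x : S) : 𝔸 := ∑ ν, covDstar T U ν (curl T U A' ν μ) x

/-- FIRST-ORDER PART of `(D¹_{U′U}A′)_{νμ}(z) − (D¹_U A′)_{νμ}(z)` ((3.70) expanded, `covD_prodCfg_expand` twice):
`iη[A_ν(z), R(U_ν(z))A′_μ(z+e_ν)] − iη[A_μ(z), R(U_μ(z))A′_ν(z+e_μ)]`. [folklore] [cite: Balaban1985BackgroundPropagators, (3.70) p.404] -/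
def curlE₁ (η : ℝ) (A A' : ι → S → 𝔸) (ν μ : ι) (z : S) : 𝔸 :=
  ad (((I * η : ℂ)) • A ν z) (R (U ν z) (A' μ (T ν z))) - ad (((I * η : ℂ)) • A μ z) (R (U μ z) (A' ν (T μ z)))

/-- HIGHER-ORDER PART of the same difference: the two conjugation remainders `𝓕(iηA_ν(z), ·) − 𝓕(iηA_μ(z), ·)` («taking the remainder
of the expansion R(U′) = exp ηiad_A = 1 + ηiad_A + ⋯», p. 405). [folklore] [cite: Balaban1985BackgroundPropagators, (3.70) p.404, p.405] -/
def curlE₂ (η : ℝ) (A A' : ι → S → 𝔸) (ν μ : ι) (z : S) : 𝔸 :=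
  conjRem (((I * η : ℂ)) • A ν z) (R (U ν z) (A' μ (T ν z))) - conjRem (((I * η : ℂ)) • A μ z) (R (U μ z) (A' ν (T μ z)))

/-- THE FIVE-TERM BRACKET of the MIDDLE expression of (3.71), direction `ν`, letters verbatim (`y = x − e_ν = (T ν)⁻¹x`,
`R(U(x, x−e_ν)) = R(U_ν(y)⁻¹)` by (3.5)): «ηR(U(x, x − ηe_ν))iad_{A_ν(x−ηe_ν)}(D_U A′)_{νμ}(x − ηe_ν) − R(U(x, x − ηe_ν))iad_{A_ν(x−ηe_ν)}
R(U(x − ηe_ν, x))A′_μ(x) + R(U(x, x − ηe_ν))iad_{A_μ(x−ηe_ν)}R(U(x − ηe_ν, x − ηe_ν + ηe_μ))·A′_ν(x − ηe_ν + ηe_μ)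
+ iad_{A_ν(x)}R(U(x, x + ηe_ν))A′_μ(x + ηe_ν) − iad_{A_μ(x)}R(U(x, x + ηe_μ))A′_ν(x + ηe_μ)». [folklore]
[cite: Balaban1985BackgroundPropagators, (3.71) p.404] -/
def tBracket (η : ℝ) (A A' : ι → S → 𝔸) (ν μ : ι) (x : S) : 𝔸 :=
  R (U ν ((T ν).symm x))⁻¹ (ad (((I * η : ℂ)) • A ν ((T ν).symm x)) (curl T U A' ν μ ((T ν).symm x)))
  - R (U ν ((T ν).symm x))⁻¹ (ad (((I * η : ℂ)) • A ν ((T ν).symm x)) (R (U ν ((T ν).symm x)) (A' μ x)))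
  + R (U ν ((T ν).symm x))⁻¹
      (ad (((I * η : ℂ)) • A μ ((T ν).symm x)) (R (U μ ((T ν).symm x)) (A' ν (T μ ((T ν).symm x)))))
  + ad (((I * η : ℂ)) • A ν x) (R (U ν x) (A' μ (T ν x)))
  - ad (((I * η : ℂ)) • A μ x) (R (U μ x) (A' ν (T μ x)))

/-- THE SEVEN-TERM BRACKET of the LAST expression of (3.71) — the summand of `(V₁(A)A′)_μ(x)` — letters verbatim, with
`(D*_νA_ν)(x) = R(U(x,x−e_ν))A_ν(x−e_ν) − A_ν(x)` = `covDstar T U ν (A ν) x`, `(D_νA′_μ)(x)` = `covD T U ν (A' μ) x`,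
`(DA′)_{νμ}` = `curl T U A' ν μ`: «R(U(x, x − ηe_ν))iad_{A_ν(x−ηe_ν)}(DA′)_{νμ}(x − ηe_ν) − iad_{(D*_νA_ν)(x)}A′_μ(x)
+ R(U(x, x − ηe_ν))iad_{A_μ(x−ηe_ν)}(D_μA′_ν)(x − ηe_ν) + iad_{A_ν(x)}(D_νA′_μ)(x) − iad_{A_μ(x)}(D_μA′_ν)(x)
+ iad_{(D*_νA_μ)(x)}R(U(x, x − ηe_ν))A′_ν(x − ηe_ν) + iad_{A_μ(x)}(D*_νA′_ν)(x)». [folklore] [cite: Balaban1985BackgroundPropagators, (3.71) p.404–405] -/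
def sBracket (η : ℝ) (A A' : ι → S → 𝔸) (ν μ : ι) (x : S) : 𝔸 :=
  R (U ν ((T ν).symm x))⁻¹ (ad (((I * η : ℂ)) • A ν ((T ν).symm x)) (curl T U A' ν μ ((T ν).symm x)))
  - ad (((I * η : ℂ)) • covDstar T U ν (A ν) x) (A' μ x)
  + R (U ν ((T ν).symm x))⁻¹ (ad (((I * η : ℂ)) • A μ ((T ν).symm x)) (covD T U μ (A' ν) ((T ν).symm x)))
  + ad (((I * η : ℂ)) • A ν x) (covD T U ν (A' μ) x)
  - ad (((I * η : ℂ)) • A μ x) (covD T U μ (A' ν) x)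
  + ad (((I * η : ℂ)) • covDstar T U ν (A μ) x) (R (U ν ((T ν).symm x))⁻¹ (A' ν ((T ν).symm x)))
  + ad (((I * η : ℂ)) • A μ x) (covDstar T U ν (A' ν) x)

/-- THE HIGHER-ORDER TERMS of the composition, direction `ν` (`a_ν = iηR(U(x,x−e_ν))A_ν(x−e_ν)`, `y = x − e_ν`):
`D¹*_{U,ν}(E₂)(x) − [a_ν, R(U(x,x−e_ν))(E₁ + E₂)(y)] + 𝓕(−a_ν, R(U(x,x−e_ν))(D¹_{U′U}A′)_{νμ}(y))` — every product of two or more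
expansion letters («taking the remainder of the expansion … in the expressions above»). [folklore]
[cite: Balaban1985BackgroundPropagators, (3.71) p.404, p.405] -/
def fRem (η : ℝ) (A A' : ι → S → 𝔸) (ν μ : ι) (x : S) : 𝔸 :=
  covDstar T U ν (curlE₂ T U η A A' ν μ) x
  - ad (((I * η : ℂ)) • R (U ν ((T ν).symm x))⁻¹ (A ν ((T ν).symm x)))
      (R (U ν ((T ν).symm x))⁻¹ (curlE₁ T U η A A' ν μ ((T ν).symm x) + curlE₂ T U η A A' ν μ ((T ν).symm x)))
  + conjRem (-(((I * η : ℂ)) • R (U ν ((T ν).symm x))⁻¹ (A ν ((T ν).symm x))))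
      (R (U ν ((T ν).symm x))⁻¹ (curl T (prodCfg U η A) A' ν μ ((T ν).symm x)))

/-- **`F_{1,k}(A)A′`** of (3.71)/(3.72), EXPLICITLY: `(F₁(A)A′)_μ(x) = −Σ_ν fRem_ν` (the print's sign: «… ] − (F_{1,k}(A)A′)_μ(x)»).
[folklore] [cite: Balaban1985BackgroundPropagators, (3.71) p.404, (3.72) p.405] -/
def F₁op [Fintype ι] (η : ℝ) (A A' : ι → S → 𝔸) (μ : ι) (x : S) : 𝔸 := -∑ ν, fRem T U η A A' ν μ x

/-- **`V₁(A)A′`** — THE OPERATOR DEFINED BY THE LAST EQUALITY of (3.71), «… − Σ_{ν=1}^d[ ⋯ ] − (F_{1,k}(A)A′)_μ(x) = (D*DA′)_μ(x) −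
(V₁(A)A′)_μ(x). (3.71)»: `(V₁(A)A′)_μ(x) = Σ_ν (seven-term bracket)_ν + (F_{1,k}(A)A′)_μ(x)` — first AND higher orders in `A` (whence
the `|A|²|A′|` of (3.73)); here `V₁op = Σ_ν sBracket_ν + F₁op` (×`η²`). [folklore] [cite: Balaban1985BackgroundPropagators, (3.71) p.405] -/
def V₁op [Fintype ι] (η : ℝ) (A A' : ι → S → 𝔸) (μ : ι) (x : S) : 𝔸 :=
  ∑ ν, sBracket T U η A A' ν μ x + F₁op T U η A A' μ x

end Objects

/-! ## §3  (3.71) as kernel identities -/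

section Eq371

variable {𝔸 : Type*} [NormedRing 𝔸] [NormedAlgebra ℂ 𝔸] [CompleteSpace 𝔸] {S : Type*} {ι : Type*}
variable (T : ι → Equiv.Perm S) (U : ι → S → 𝔸ˣ)

omit [NormedAlgebra ℂ 𝔸] [CompleteSpace 𝔸] in
/-- The first line of (3.71) IS the plaquette adjoint (3.9) of the curl: `D¹*D¹A′ = D*(D A′)` in the last form of (3.9)
(`B9Eq39Adjoint.divP_eq_sum_of_antisymm` with `curl_swap`/`curl_self`, BY NAME). [folklore] [cite: Balaban1985BackgroundPropagators, (3.9) p.392, (3.71) p.404] -/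
theorem lapDD_eq_divP_curl [Fintype ι] [LinearOrder ι] (A' : ι → S → 𝔸) (μ : ι) (x : S) :
    lapDD T U A' μ x = divP T U (curl T U A') μ x := by
  rw [lapDD, divP_eq_sum_of_antisymm]
  · exact fun μ ν x => curl_swap T U A' μ ν x
  · exact fun μ x => curl_self T U A' μ x

/-- (3.70) for the curl, split into orders: `(D¹_{U′U}A′)_{νμ}(z) = (D¹_UA′)_{νμ}(z) + E₁(z) + E₂(z)`. [folklore]
[cite: Balaban1985BackgroundPropagators, (3.70) p.404] -/
theorem curl_prodCfg_expand (η : ℝ) (A A' : ι → S → 𝔸) (ν μ : ι) (z : S) :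
    curl T (prodCfg U η A) A' ν μ z
      = curl T U A' ν μ z + curlE₁ T U η A A' ν μ z + curlE₂ T U η A A' ν μ z := by
  simp only [curl, covD_prodCfg_expand, curlE₁, curlE₂]
  abel

/-- **(3.71), SECOND EQUALITY, PER DIRECTION**: `D¹*_{U′U,ν}(D¹_{U′U}A′)_{νμ}(x) = D¹*_{U,ν}(D¹_UA′)_{νμ}(x) − tBracket_ν(x) + fRem_ν(x)` —
the composition of the two expansions (3.70)/(3.74) with the first-order terms collected in the print's five-term bracket (the
regrouping `R(V)[b, Z] = [R(V)b, R(V)Z]` of the `D*`-expansion's vertex is `R_ad`) and ALL higher-order terms in `fRem`. [folklore]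
[cite: Balaban1985BackgroundPropagators, (3.71) p.404] -/
theorem covDstar_curl_prodCfg (η : ℝ) (A A' : ι → S → 𝔸) (ν μ : ι) (x : S) :
    covDstar T (prodCfg U η A) ν (curl T (prodCfg U η A) A' ν μ) x
      = covDstar T U ν (curl T U A' ν μ) x - tBracket T U η A A' ν μ x + fRem T U η A A' ν μ x := by
  rw [covDstar_prodCfg_expand]
  simp only [covDstar, tBracket, fRem, curl_prodCfg_expand, R_add, R_sub, ad_add_right, ad_sub_right, curlE₁, R_ad,
    R_Iη_smul, R_inv_R, Equiv.apply_symm_apply]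
  abel

/-- **(3.71), FIRST AND SECOND EQUALITY**: `(D¹*_{U′U}D¹_{U′U}A′)_μ(x) = (D¹*_UD¹_UA′)_μ(x) − Σ_ν tBracket_ν(x) − (F₁(A)A′)_μ(x)`
(the print's display ×`η²`). [folklore] [cite: Balaban1985BackgroundPropagators, (3.71) p.404] -/
theorem lapDD_prodCfg_eq_tBracket [Fintype ι] (η : ℝ) (A A' : ι → S → 𝔸) (μ : ι) (x : S) :
    lapDD T (prodCfg U η A) A' μ x
      = lapDD T U A' μ x - ∑ ν, tBracket T U η A A' ν μ x - F₁op T U η A A' μ x := by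
  simp only [lapDD, F₁op, covDstar_curl_prodCfg, Finset.sum_add_distrib, Finset.sum_sub_distrib, sub_neg_eq_add]

omit [CompleteSpace 𝔸] in
/-- **(3.71), THIRD EQUALITY — THE REGROUPING**, per direction: the five-term bracket EQUALS the seven-term bracket
(`R(U(x,x−e_ν))iad_{A(x−e_ν)}R(U(x−e_ν,x)) = iad_{R(U(x,x−e_ν))A(x−e_ν)}` and every transported letter `R(U(y,y′))A′(y′)` split as
covariant difference + local letter). [folklore] [cite: Balaban1985BackgroundPropagators, (3.71) p.404–405] -/
theorem tBracket_eq_sBracket (η : ℝ) (A A' : ι → S → 𝔸) (ν μ : ι) (x : S) :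
    tBracket T U η A A' ν μ x = sBracket T U η A A' ν μ x := by
  simp only [tBracket, sBracket, covDstar, covD, R_ad, R_Iη_smul, R_inv_R, R_sub, ad_smul_left, ad_sub_left, ad_sub_right,
    smul_sub]
  abel

/-- **(3.71), PENULTIMATE EXPRESSION**: `(D¹*_{U′U}D¹_{U′U}A′)_μ(x) = (D¹*_UD¹_UA′)_μ(x) − Σ_ν sBracket_ν(x) − (F₁(A)A′)_μ(x)`
(«= (D*DA′)_μ(x) − Σ_{ν=1}^d[ ⋯ seven terms ⋯ ] − (F_{1,k}(A)A′)_μ(x)»; ×`η²`). [folklore] [cite: Balaban1985BackgroundPropagators, (3.71) p.404–405] -/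
theorem lapDD_prodCfg_eq_sBracket [Fintype ι] (η : ℝ) (A A' : ι → S → 𝔸) (μ : ι) (x : S) :
    lapDD T (prodCfg U η A) A' μ x
      = lapDD T U A' μ x - ∑ ν, sBracket T U η A A' ν μ x - F₁op T U η A A' μ x := by
  simp only [lapDD_prodCfg_eq_tBracket, tBracket_eq_sBracket]

/-- **(3.71)**: `(D¹*_{U′U}D¹_{U′U}A′)_μ(x) = (D¹*_UD¹_UA′)_μ(x) − (V₁(A)A′)_μ(x)` («= (D*DA′)_μ(x) − (V₁(A)A′)_μ(x). (3.71)»; ×`η²`), with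
`V₁(A)A′ = Σ_ν(seven-term bracket)_ν + F_{1,k}(A)A′` as the print defines it and `F_{1,k}` EXPLICIT (`F₁op`). [folklore]
[cite: Balaban1985BackgroundPropagators, (3.71) p.404–405] -/
theorem lapDD_prodCfg [Fintype ι] (η : ℝ) (A A' : ι → S → 𝔸) (μ : ι) (x : S) :
    lapDD T (prodCfg U η A) A' μ x = lapDD T U A' μ x - V₁op T U η A A' μ x := by
  rw [lapDD_prodCfg_eq_sBracket, V₁op, sub_sub]

omit [NormedAlgebra ℂ 𝔸] [CompleteSpace 𝔸] in
/-- `D¹*_ν` is the transported forward derivative: `(D¹*_{U,ν}G)(x) = −R(U(x,x−e_ν))(D¹_{U,ν}G)(x−e_ν)` ((3.8) with (3.5)). [folklore]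
[cite: Balaban1985BackgroundPropagators, (3.8) p.392, (3.5) p.391] -/
theorem covDstar_eq_neg_R_covD (ν : ι) (G : S → 𝔸) (x : S) :
    covDstar T U ν G x = -R (U ν ((T ν).symm x))⁻¹ (covD T U ν G ((T ν).symm x)) := by
  simp only [covDstar, covD, R_sub, R_inv_R, Equiv.apply_symm_apply]
  abel

end Eq371

/-! ## §4  (3.72) and (3.73): the bounds, every `O(1)` explicit (uniform sup hypotheses in place of the `st(b)`-sups) -/

section Bounds

variable {𝔸 : Type*} [NormedRing 𝔸] [NormedAlgebra ℂ 𝔸] [CompleteSpace 𝔸] {S : Type*} {ι : Type*}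
variable (T : ι → Equiv.Perm S) (U : ι → S → 𝔸ˣ)

omit [CompleteSpace 𝔸] in
/-- `‖E₁(z)‖ ≤ 4sw` for `‖iηA(b)‖ ≤ s` and transported letters `‖R(U(b))A′(b₊)‖ ≤ w`. [folklore] -/
theorem norm_curlE₁_le {η s w : ℝ} (hs : 0 ≤ s) (A A' : ι → S → 𝔸)
    (hb : ∀ κ z, ‖((I * η : ℂ)) • A κ z‖ ≤ s) (hY : ∀ κ τ z, ‖R (U κ z) (A' τ (T κ z))‖ ≤ w) (ν μ : ι) (z : S) :
    ‖curlE₁ T U η A A' ν μ z‖ ≤ 4 * s * w := by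
  have h : ∀ κ τ, ‖ad (((I * η : ℂ)) • A κ z) (R (U κ z) (A' τ (T κ z)))‖ ≤ 2 * s * w := fun κ τ =>
    (norm_ad_le_of_le (hb κ z) _).trans (mul_le_mul_of_nonneg_left (hY κ τ z) (by linarith))
  unfold curlE₁
  exact (norm_sub_le _ _).trans (by linarith [h ν μ, h μ ν])

/-- `‖E₂(z)‖ ≤ 4s²e^{2s}w` — the two one-transport remainders (`norm_conjRem_le_sq`). [folklore]
[cite: Balaban1985BackgroundPropagators, (3.72) p.405] -/
theorem norm_curlE₂_le {η s w : ℝ} (A A' : ι → S → 𝔸)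
    (hb : ∀ κ z, ‖((I * η : ℂ)) • A κ z‖ ≤ s) (hY : ∀ κ τ z, ‖R (U κ z) (A' τ (T κ z))‖ ≤ w) (ν μ : ι) (z : S) :
    ‖curlE₂ T U η A A' ν μ z‖ ≤ 4 * s ^ 2 * Real.exp (2 * s) * w := by
  have h : ∀ κ τ, ‖conjRem (((I * η : ℂ)) • A κ z) (R (U κ z) (A' τ (T κ z)))‖ ≤ 2 * s ^ 2 * Real.exp (2 * s) * w :=
    fun κ τ => (norm_conjRem_le_of_le (hb κ z) _).trans (mul_le_mul_of_nonneg_left (hY κ τ z) (by positivity))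
  unfold curlE₂
  exact (norm_sub_le _ _).trans (by linarith [h ν μ, h μ ν])

omit [NormedAlgebra ℂ 𝔸] [CompleteSpace 𝔸] in
/-- `‖(D¹_κA′_τ)(z)‖ ≤ 2w` from the letter bounds. [folklore] -/
theorem norm_covD_le_of {w : ℝ} (A' : ι → S → 𝔸) (hY : ∀ κ τ z, ‖R (U κ z) (A' τ (T κ z))‖ ≤ w)
    (hA' : ∀ κ z, ‖A' κ z‖ ≤ w) (κ τ : ι) (z : S) : ‖covD T U κ (A' τ) z‖ ≤ 2 * w := by
  unfold covD
  exact (norm_sub_le _ _).trans (by linarith [hY κ τ z, hA' τ z])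

omit [NormedAlgebra ℂ 𝔸] [CompleteSpace 𝔸] in
/-- `‖(D¹A′)_{νμ}(z)‖ ≤ 4w`. [folklore] -/
theorem norm_curl_le_of {w : ℝ} (A' : ι → S → 𝔸) (hY : ∀ κ τ z, ‖R (U κ z) (A' τ (T κ z))‖ ≤ w)
    (hA' : ∀ κ z, ‖A' κ z‖ ≤ w) (ν μ : ι) (z : S) : ‖curl T U A' ν μ z‖ ≤ 4 * w := by
  unfold curl
  exact (norm_sub_le _ _).trans (by linarith [norm_covD_le_of T U A' hY hA' ν μ z, norm_covD_le_of T U A' hY hA' μ ν z])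

/-- `‖(D¹_{U′U}A′)_{νμ}(z)‖ ≤ 4w(1 + s + s²e^{2s})`. [folklore] [cite: Balaban1985BackgroundPropagators, (3.70) p.404] -/
theorem norm_curl_prodCfg_le {η s w : ℝ} (hs : 0 ≤ s) (A A' : ι → S → 𝔸)
    (hb : ∀ κ z, ‖((I * η : ℂ)) • A κ z‖ ≤ s) (hY : ∀ κ τ z, ‖R (U κ z) (A' τ (T κ z))‖ ≤ w)
    (hA' : ∀ κ z, ‖A' κ z‖ ≤ w) (ν μ : ι) (z : S) :
    ‖curl T (prodCfg U η A) A' ν μ z‖ ≤ 4 * w * (1 + s + s ^ 2 * Real.exp (2 * s)) := by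
  rw [curl_prodCfg_expand]
  have h1 := norm_curl_le_of T U A' hY hA' ν μ z
  have h2 := norm_curlE₁_le T U hs A A' hb hY ν μ z
  have h3 := norm_curlE₂_le T U A A' hb hY ν μ z
  calc _ ≤ 4 * w + 4 * s * w + 4 * s ^ 2 * Real.exp (2 * s) * w :=
        norm_add_le_of_le (norm_add_le_of_le h1 h2) h3
    _ = 4 * w * (1 + s + s ^ 2 * Real.exp (2 * s)) := by ring

/-- **THE HIGHER-ORDER TERMS, ONE DIRECTION, ABSTRACT SIZES**: with `‖iηA(b)‖ ≤ s`, `‖iηR(U(x,x−e_ν))A_ν(x−e_ν)‖ ≤ s`, transport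
size `‖U(b)‖, ‖U(b)⁻¹‖ ≤ ρ`, `ρ ≥ 1`, and `A′`-letters `≤ w`:  `‖fRem_ν(x)‖ ≤ 8ρ²s²e^{2s}w(3 + 2s + s²e^{2s})` — quadratic in `s`
(«|(F_{1,k}(A)A′)_μ(x)| ≤ O(1)|A|²|A′|»). [folklore] [cite: Balaban1985BackgroundPropagators, (3.72) p.405] -/
theorem norm_fRem_le_of {η s w ρ : ℝ} (hs : 0 ≤ s) (hw : 0 ≤ w) (hρ : 1 ≤ ρ)
    (hU : ∀ κ z, ‖(U κ z : 𝔸)‖ ≤ ρ) (hU' : ∀ κ z, ‖(((U κ z)⁻¹ : 𝔸ˣ) : 𝔸)‖ ≤ ρ) (A A' : ι → S → 𝔸)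
    (hb : ∀ κ z, ‖((I * η : ℂ)) • A κ z‖ ≤ s) (hbt : ∀ κ z, ‖((I * η : ℂ)) • R (U κ z)⁻¹ (A κ z)‖ ≤ s)
    (hY : ∀ κ τ z, ‖R (U κ z) (A' τ (T κ z))‖ ≤ w) (hA' : ∀ κ z, ‖A' κ z‖ ≤ w) (ν μ : ι) (x : S) :
    ‖fRem T U η A A' ν μ x‖
      ≤ 8 * ρ ^ 2 * s ^ 2 * Real.exp (2 * s) * w * (3 + 2 * s + s ^ 2 * Real.exp (2 * s)) := by
  have hE1 : 1 ≤ Real.exp (2 * s) := Real.one_le_exp (by linarith)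
  have hρ2 : 1 ≤ ρ ^ 2 := one_le_pow₀ hρ
  have hRt : ∀ Z : 𝔸, ‖R (U ν ((T ν).symm x))⁻¹ Z‖ ≤ ρ ^ 2 * ‖Z‖ := fun Z =>
    norm_R_le_sq _ (hU' ν _) (by rw [inv_inv]; exact hU ν _) Z
  have hE1y := norm_curlE₁_le T U hs A A' hb hY ν μ ((T ν).symm x)
  have hE2y := norm_curlE₂_le T U A A' hb hY ν μ ((T ν).symm x)
  have hE2x := norm_curlE₂_le T U A A' hb hY ν μ x
  have hC := norm_curl_prodCfg_le T U hs A A' hb hY hA' ν μ ((T ν).symm x)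
  have P1 : ‖covDstar T U ν (curlE₂ T U η A A' ν μ) x‖ ≤ 8 * ρ ^ 2 * s ^ 2 * Real.exp (2 * s) * w := by
    have h1 : ‖R (U ν ((T ν).symm x))⁻¹ (curlE₂ T U η A A' ν μ ((T ν).symm x))‖
        ≤ ρ ^ 2 * (4 * s ^ 2 * Real.exp (2 * s) * w) :=
      (hRt _).trans (mul_le_mul_of_nonneg_left hE2y (by positivity))
    have h2 : ‖curlE₂ T U η A A' ν μ x‖ ≤ ρ ^ 2 * (4 * s ^ 2 * Real.exp (2 * s) * w) :=
      hE2x.trans (le_mul_of_one_le_left (by positivity) hρ2)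
    unfold covDstar
    exact (norm_sub_le_of_le h1 h2).trans (le_of_eq (by ring))
  have P2 : ‖ad (((I * η : ℂ)) • R (U ν ((T ν).symm x))⁻¹ (A ν ((T ν).symm x)))
        (R (U ν ((T ν).symm x))⁻¹
          (curlE₁ T U η A A' ν μ ((T ν).symm x) + curlE₂ T U η A A' ν μ ((T ν).symm x)))‖
      ≤ 8 * ρ ^ 2 * s ^ 2 * w * (1 + s * Real.exp (2 * s)) := by
    have h1 : ‖R (U ν ((T ν).symm x))⁻¹
          (curlE₁ T U η A A' ν μ ((T ν).symm x) + curlE₂ T U η A A' ν μ ((T ν).symm x))‖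
        ≤ ρ ^ 2 * (4 * s * w + 4 * s ^ 2 * Real.exp (2 * s) * w) :=
      (hRt _).trans (mul_le_mul_of_nonneg_left (norm_add_le_of_le hE1y hE2y) (by positivity))
    calc _ ≤ 2 * s * ‖R (U ν ((T ν).symm x))⁻¹
              (curlE₁ T U η A A' ν μ ((T ν).symm x) + curlE₂ T U η A A' ν μ ((T ν).symm x))‖ :=
          norm_ad_le_of_le (hbt ν _) _
      _ ≤ 2 * s * (ρ ^ 2 * (4 * s * w + 4 * s ^ 2 * Real.exp (2 * s) * w)) :=
          mul_le_mul_of_nonneg_left h1 (by linarith)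
      _ = 8 * ρ ^ 2 * s ^ 2 * w * (1 + s * Real.exp (2 * s)) := by ring
  have P3 : ‖conjRem (-(((I * η : ℂ)) • R (U ν ((T ν).symm x))⁻¹ (A ν ((T ν).symm x))))
        (R (U ν ((T ν).symm x))⁻¹ (curl T (prodCfg U η A) A' ν μ ((T ν).symm x)))‖
      ≤ 8 * ρ ^ 2 * s ^ 2 * Real.exp (2 * s) * w * (1 + s + s ^ 2 * Real.exp (2 * s)) := by
    have hb' : ‖-(((I * η : ℂ)) • R (U ν ((T ν).symm x))⁻¹ (A ν ((T ν).symm x)))‖ ≤ s := by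
      rw [norm_neg]; exact hbt ν _
    have h1 : ‖R (U ν ((T ν).symm x))⁻¹ (curl T (prodCfg U η A) A' ν μ ((T ν).symm x))‖
        ≤ ρ ^ 2 * (4 * w * (1 + s + s ^ 2 * Real.exp (2 * s))) :=
      (hRt _).trans (mul_le_mul_of_nonneg_left hC (by positivity))
    calc _ ≤ 2 * s ^ 2 * Real.exp (2 * s)
            * ‖R (U ν ((T ν).symm x))⁻¹ (curl T (prodCfg U η A) A' ν μ ((T ν).symm x))‖ :=
          norm_conjRem_le_of_le hb' _
      _ ≤ 2 * s ^ 2 * Real.exp (2 * s) * (ρ ^ 2 * (4 * w * (1 + s + s ^ 2 * Real.exp (2 * s)))) :=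
          mul_le_mul_of_nonneg_left h1 (by positivity)
      _ = 8 * ρ ^ 2 * s ^ 2 * Real.exp (2 * s) * w * (1 + s + s ^ 2 * Real.exp (2 * s)) := by ring
  have hsum : ‖fRem T U η A A' ν μ x‖
      ≤ 8 * ρ ^ 2 * s ^ 2 * Real.exp (2 * s) * w + 8 * ρ ^ 2 * s ^ 2 * w * (1 + s * Real.exp (2 * s))
        + 8 * ρ ^ 2 * s ^ 2 * Real.exp (2 * s) * w * (1 + s + s ^ 2 * Real.exp (2 * s)) := by
    unfold fRem
    exact norm_add_le_of_le (norm_sub_le_of_le P1 P2) P3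
  have hgap : 0 ≤ 8 * ρ ^ 2 * s ^ 2 * w * (Real.exp (2 * s) - 1) :=
    mul_nonneg (by positivity) (sub_nonneg.mpr hE1)
  have key : 8 * ρ ^ 2 * s ^ 2 * Real.exp (2 * s) * w + 8 * ρ ^ 2 * s ^ 2 * w * (1 + s * Real.exp (2 * s))
        + 8 * ρ ^ 2 * s ^ 2 * Real.exp (2 * s) * w * (1 + s + s ^ 2 * Real.exp (2 * s))
        + 8 * ρ ^ 2 * s ^ 2 * w * (Real.exp (2 * s) - 1)
      = 8 * ρ ^ 2 * s ^ 2 * Real.exp (2 * s) * w * (3 + 2 * s + s ^ 2 * Real.exp (2 * s)) := by ring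
  linarith

/-- **(3.72), FIRST INEQUALITY** — `|(F_{1,k}(A)A′)_μ(x)| ≤ O(1)|A|²|A′|` — on the carrier, one direction, with the uniform sups
`‖A(b)‖ ≤ a`, `‖A′(b)‖ ≤ a′` (in place of the sups over `st(b)`) and transport size `ρ ≥ 1` (`‖U(b)‖, ‖U(b)⁻¹‖ ≤ ρ`; `ρ = 1` for a
`G`-valued background in an operator norm):  `‖fRem_ν(x)‖ ≤ 8ρ⁴s²e^{2s}(3 + 2s + s²e^{2s})·a′`, `s = ηρ²a` — `O(1) = 8ρ⁸e^{2s}(3 + 2s +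
s²e^{2s})` times `(ηa)²a′` (the `η²` is the normalisation `D¹ = ηD`, twice). [folklore] [cite: Balaban1985BackgroundPropagators, (3.72) p.405] -/
theorem norm_fRem_le {η ρ a a' : ℝ} (hη : 0 ≤ η) (hρ : 1 ≤ ρ)
    (hU : ∀ κ z, ‖(U κ z : 𝔸)‖ ≤ ρ) (hU' : ∀ κ z, ‖(((U κ z)⁻¹ : 𝔸ˣ) : 𝔸)‖ ≤ ρ)
    (A A' : ι → S → 𝔸) (hA : ∀ κ z, ‖A κ z‖ ≤ a) (hA' : ∀ κ z, ‖A' κ z‖ ≤ a') (ν μ : ι) (x : S) :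
    ‖fRem T U η A A' ν μ x‖
      ≤ 8 * ρ ^ 4 * (η * ρ ^ 2 * a) ^ 2 * Real.exp (2 * (η * ρ ^ 2 * a))
          * (3 + 2 * (η * ρ ^ 2 * a) + (η * ρ ^ 2 * a) ^ 2 * Real.exp (2 * (η * ρ ^ 2 * a))) * a' := by
  have ha : 0 ≤ a := (norm_nonneg _).trans (hA ν x)
  have ha' : 0 ≤ a' := (norm_nonneg _).trans (hA' ν x)
  have hρ0 : 0 ≤ ρ := zero_le_one.trans hρ
  have hρ2 : 1 ≤ ρ ^ 2 := one_le_pow₀ hρ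
  have hs : 0 ≤ η * ρ ^ 2 * a := by positivity
  have hw : 0 ≤ ρ ^ 2 * a' := by positivity
  have hb : ∀ κ z, ‖((I * η : ℂ)) • A κ z‖ ≤ η * ρ ^ 2 * a := fun κ z => by
    rw [norm_Iη_smul hη]
    calc η * ‖A κ z‖ ≤ η * a := mul_le_mul_of_nonneg_left (hA κ z) hη
      _ ≤ η * (ρ ^ 2 * a) := mul_le_mul_of_nonneg_left (le_mul_of_one_le_left ha hρ2) hη
      _ = η * ρ ^ 2 * a := by ring
  have hbt : ∀ κ z, ‖((I * η : ℂ)) • R (U κ z)⁻¹ (A κ z)‖ ≤ η * ρ ^ 2 * a := fun κ z => by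
    rw [norm_Iη_smul hη]
    have h := norm_R_le_sq (U κ z)⁻¹ (hU' κ z) (by rw [inv_inv]; exact hU κ z) (A κ z)
    calc η * ‖R (U κ z)⁻¹ (A κ z)‖ ≤ η * (ρ ^ 2 * a) :=
          mul_le_mul_of_nonneg_left (h.trans (mul_le_mul_of_nonneg_left (hA κ z) (by positivity))) hη
      _ = η * ρ ^ 2 * a := by ring
  have hY : ∀ κ τ z, ‖R (U κ z) (A' τ (T κ z))‖ ≤ ρ ^ 2 * a' := fun κ τ z =>
    (norm_R_le_sq (U κ z) (hU κ z) (hU' κ z) _).trans (mul_le_mul_of_nonneg_left (hA' τ _) (by positivity))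
  have hA'w : ∀ κ z, ‖A' κ z‖ ≤ ρ ^ 2 * a' := fun κ z => (hA' κ z).trans (le_mul_of_one_le_left ha' hρ2)
  calc _ ≤ _ := norm_fRem_le_of T U hs hw hρ hU hU' A A' hb hbt hY hA'w ν μ x
    _ = _ := by ring

/-- **(3.72) FOR `F₁(A)A′ = −Σ_ν fRem_ν`**: `‖(F₁(A)A′)_μ(x)‖ ≤ d·8ρ⁴s²e^{2s}(3 + 2s + s²e^{2s})·a′`, `d = |ι|`, `s = ηρ²a`. [folklore]
[cite: Balaban1985BackgroundPropagators, (3.72) p.405] -/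
theorem norm_F₁op_le [Fintype ι] {η ρ a a' : ℝ} (hη : 0 ≤ η) (hρ : 1 ≤ ρ)
    (hU : ∀ κ z, ‖(U κ z : 𝔸)‖ ≤ ρ) (hU' : ∀ κ z, ‖(((U κ z)⁻¹ : 𝔸ˣ) : 𝔸)‖ ≤ ρ)
    (A A' : ι → S → 𝔸) (hA : ∀ κ z, ‖A κ z‖ ≤ a) (hA' : ∀ κ z, ‖A' κ z‖ ≤ a') (μ : ι) (x : S) :
    ‖F₁op T U η A A' μ x‖
      ≤ Fintype.card ι * (8 * ρ ^ 4 * (η * ρ ^ 2 * a) ^ 2 * Real.exp (2 * (η * ρ ^ 2 * a))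
          * (3 + 2 * (η * ρ ^ 2 * a) + (η * ρ ^ 2 * a) ^ 2 * Real.exp (2 * (η * ρ ^ 2 * a))) * a') := by
  unfold F₁op
  rw [norm_neg]
  calc _ ≤ ∑ ν, ‖fRem T U η A A' ν μ x‖ := norm_sum_le _ _
    _ ≤ ∑ _ν : ι, 8 * ρ ^ 4 * (η * ρ ^ 2 * a) ^ 2 * Real.exp (2 * (η * ρ ^ 2 * a))
          * (3 + 2 * (η * ρ ^ 2 * a) + (η * ρ ^ 2 * a) ^ 2 * Real.exp (2 * (η * ρ ^ 2 * a))) * a' :=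
        Finset.sum_le_sum fun ν _ => norm_fRem_le T U hη hρ hU hU' A A' hA hA' ν μ x
    _ = _ := by simp [Finset.sum_const, Finset.card_univ, nsmul_eq_mul]

/-- **(3.72), SECOND INEQUALITY, AT THE PRINTED SCALE** (unitary-size background `ρ = 1`; (3.37) at the letters: `‖A(b)‖ ≤ a ≤ α₁(L^jη)⁻¹`,
`L ≥ 1`, `η > 0`, so `s = ηa ≤ α₁L^{−j} ≤ α₁`):  `‖(F₁(A)A′)_μ(x)‖ ≤ d·8e^{2α₁}(3 + 2α₁ + α₁²e^{2α₁})·α₁²·L^{−2j}·a′` — i.e. `η²` times the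
print's `O(1)α₁²(L^jη)⁻²|A′|` with `O(1) = 8d·e^{2α₁}(3 + 2α₁ + α₁²e^{2α₁})` («an absolute constant depending on d only» once `α₁ ≤ 1`).
[folklore] [cite: Balaban1985BackgroundPropagators, (3.72) p.405, (3.37) p.396] -/
theorem norm_F₁op_le_printed [Fintype ι] {η L α₁ a a' : ℝ} {j : ℕ} (hη : 0 < η) (hL : 1 ≤ L)
    (hU : ∀ κ z, ‖(U κ z : 𝔸)‖ ≤ 1) (hU' : ∀ κ z, ‖(((U κ z)⁻¹ : 𝔸ˣ) : 𝔸)‖ ≤ 1)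
    (A A' : ι → S → 𝔸) (hA : ∀ κ z, ‖A κ z‖ ≤ a) (ha : a ≤ α₁ * (L ^ j * η)⁻¹) (hA' : ∀ κ z, ‖A' κ z‖ ≤ a')
    (μ : ι) (x : S) :
    ‖F₁op T U η A A' μ x‖
      ≤ Fintype.card ι * (8 * Real.exp (2 * α₁) * (3 + 2 * α₁ + α₁ ^ 2 * Real.exp (2 * α₁))
          * α₁ ^ 2 * ((L ^ j)⁻¹) ^ 2 * a') := by
  have h := norm_F₁op_le T U hη.le le_rfl hU hU' A A' hA hA' μ x
  have hLj : 1 ≤ L ^ j := one_le_pow₀ hL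
  have hLj0 : 0 < L ^ j := lt_of_lt_of_le one_pos hLj
  have ha0 : 0 ≤ a := (norm_nonneg _).trans (hA μ x)
  have ha'0 : 0 ≤ a' := (norm_nonneg _).trans (hA' μ x)
  have hs : η * 1 ^ 2 * a ≤ α₁ * (L ^ j)⁻¹ := by
    calc η * 1 ^ 2 * a = η * a := by ring
      _ ≤ η * (α₁ * (L ^ j * η)⁻¹) := mul_le_mul_of_nonneg_left ha hη.le
      _ = α₁ * (L ^ j)⁻¹ := by field_simp
  have hs0 : 0 ≤ η * 1 ^ 2 * a := by positivity
  have hα : 0 ≤ α₁ := by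
    by_contra hc
    have h1 : α₁ * (L ^ j)⁻¹ < 0 := mul_neg_of_neg_of_pos (lt_of_not_ge hc) (inv_pos.mpr hLj0)
    linarith
  have hs1 : η * 1 ^ 2 * a ≤ α₁ := hs.trans (mul_le_of_le_one_right hα (inv_le_one_of_one_le₀ hLj))
  have hE : Real.exp (2 * (η * 1 ^ 2 * a)) ≤ Real.exp (2 * α₁) := Real.exp_le_exp.mpr (by linarith)
  have hsq : (η * 1 ^ 2 * a) ^ 2 ≤ α₁ ^ 2 * ((L ^ j)⁻¹) ^ 2 := by
    rw [← mul_pow]; exact pow_le_pow_left₀ hs0 hs 2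
  have hsq' : (η * 1 ^ 2 * a) ^ 2 ≤ α₁ ^ 2 := pow_le_pow_left₀ hs0 hs1 2
  have hP : 3 + 2 * (η * 1 ^ 2 * a) + (η * 1 ^ 2 * a) ^ 2 * Real.exp (2 * (η * 1 ^ 2 * a))
      ≤ 3 + 2 * α₁ + α₁ ^ 2 * Real.exp (2 * α₁) := by
    have := mul_le_mul hsq' hE (by positivity) (sq_nonneg α₁)
    linarith
  refine h.trans (mul_le_mul_of_nonneg_left ?_ (Nat.cast_nonneg _))
  calc 8 * (1 : ℝ) ^ 4 * (η * 1 ^ 2 * a) ^ 2 * Real.exp (2 * (η * 1 ^ 2 * a))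
          * (3 + 2 * (η * 1 ^ 2 * a) + (η * 1 ^ 2 * a) ^ 2 * Real.exp (2 * (η * 1 ^ 2 * a))) * a'
      ≤ 8 * (1 : ℝ) ^ 4 * (α₁ ^ 2 * ((L ^ j)⁻¹) ^ 2) * Real.exp (2 * α₁)
          * (3 + 2 * α₁ + α₁ ^ 2 * Real.exp (2 * α₁)) * a' := by
        gcongr
    _ = _ := by ring

omit [CompleteSpace 𝔸] in
/-- **(3.73), FIRST INEQUALITY** — `|(V₁(A)A′)(b)| ≤ O(1)(|A||∇A′| + |∇A||A′| + |A|²|A′|)` — one direction, with uniform sups of the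
letters and of the FORWARD covariant differences ((3.39): «|∇A| = max_{μ,ν} sup_x |(D_μA_ν)(x)|»; `D¹*_ν = −R∘D¹_ν∘shift`,
`covDstar_eq_neg_R_covD`): `‖sBracket_ν(x)‖ ≤ η((8ρ² + 4)·a·g′ + 2ρ²(1 + ρ²)·g·a′)` — no `|A|²|A′|` term is needed. [folklore]
[cite: Balaban1985BackgroundPropagators, (3.73) p.405, (3.39) p.397] -/
theorem norm_sBracket_le {η ρ a a' g g' : ℝ} (hη : 0 ≤ η)
    (hU : ∀ κ z, ‖(U κ z : 𝔸)‖ ≤ ρ) (hU' : ∀ κ z, ‖(((U κ z)⁻¹ : 𝔸ˣ) : 𝔸)‖ ≤ ρ)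
    (A A' : ι → S → 𝔸) (hA : ∀ κ z, ‖A κ z‖ ≤ a) (hA' : ∀ κ z, ‖A' κ z‖ ≤ a')
    (hdA : ∀ κ τ z, ‖covD T U κ (A τ) z‖ ≤ g) (hdA' : ∀ κ τ z, ‖covD T U κ (A' τ) z‖ ≤ g') (ν μ : ι) (x : S) :
    ‖sBracket T U η A A' ν μ x‖ ≤ η * ((8 * ρ ^ 2 + 4) * a * g' + 2 * ρ ^ 2 * (1 + ρ ^ 2) * g * a') := by
  have ha : 0 ≤ a := (norm_nonneg _).trans (hA ν x)
  have ha' : 0 ≤ a' := (norm_nonneg _).trans (hA' ν x)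
  have hg : 0 ≤ g := (norm_nonneg _).trans (hdA ν ν x)
  have hg' : 0 ≤ g' := (norm_nonneg _).trans (hdA' ν ν x)
  have hρ0 : 0 ≤ ρ := (norm_nonneg _).trans (hU ν x)
  have hR : ∀ κ z (Z : 𝔸), ‖R (U κ z) Z‖ ≤ ρ ^ 2 * ‖Z‖ := fun κ z Z => norm_R_le_sq _ (hU κ z) (hU' κ z) Z
  have hRt : ∀ κ z (Z : 𝔸), ‖R (U κ z)⁻¹ Z‖ ≤ ρ ^ 2 * ‖Z‖ := fun κ z Z =>
    norm_R_le_sq _ (hU' κ z) (by rw [inv_inv]; exact hU κ z) Z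
  have hb : ∀ κ z, ‖((I * η : ℂ)) • A κ z‖ ≤ η * a := fun κ z => by
    rw [norm_Iη_smul hη]; exact mul_le_mul_of_nonneg_left (hA κ z) hη
  have hds : ∀ κ τ z, ‖covDstar T U κ (A τ) z‖ ≤ ρ ^ 2 * g := fun κ τ z => by
    rw [covDstar_eq_neg_R_covD, norm_neg]
    exact (hRt κ _ _).trans (mul_le_mul_of_nonneg_left (hdA κ τ _) (by positivity))
  have hds' : ∀ κ τ z, ‖covDstar T U κ (A' τ) z‖ ≤ ρ ^ 2 * g' := fun κ τ z => by
    rw [covDstar_eq_neg_R_covD, norm_neg]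
    exact (hRt κ _ _).trans (mul_le_mul_of_nonneg_left (hdA' κ τ _) (by positivity))
  have hbd : ∀ κ τ z, ‖((I * η : ℂ)) • covDstar T U κ (A τ) z‖ ≤ η * (ρ ^ 2 * g) := fun κ τ z => by
    rw [norm_Iη_smul hη]; exact mul_le_mul_of_nonneg_left (hds κ τ z) hη
  have hcurl : ∀ z, ‖curl T U A' ν μ z‖ ≤ 2 * g' := fun z => by
    unfold curl; exact (norm_sub_le _ _).trans (by linarith [hdA' ν μ z, hdA' μ ν z])
  -- the seven terms
  have h1 : ‖R (U ν ((T ν).symm x))⁻¹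
        (ad (((I * η : ℂ)) • A ν ((T ν).symm x)) (curl T U A' ν μ ((T ν).symm x)))‖ ≤ ρ ^ 2 * (2 * (η * a) * (2 * g')) :=
    (hRt ν _ _).trans (mul_le_mul_of_nonneg_left
      ((norm_ad_le_of_le (hb ν _) _).trans (mul_le_mul_of_nonneg_left (hcurl _) (by positivity))) (by positivity))
  have h2 : ‖ad (((I * η : ℂ)) • covDstar T U ν (A ν) x) (A' μ x)‖ ≤ 2 * (η * (ρ ^ 2 * g)) * a' :=
    (norm_ad_le_of_le (hbd ν ν x) _).trans (mul_le_mul_of_nonneg_left (hA' μ x) (by positivity))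
  have h3 : ‖R (U ν ((T ν).symm x))⁻¹
        (ad (((I * η : ℂ)) • A μ ((T ν).symm x)) (covD T U μ (A' ν) ((T ν).symm x)))‖ ≤ ρ ^ 2 * (2 * (η * a) * g') :=
    (hRt ν _ _).trans (mul_le_mul_of_nonneg_left
      ((norm_ad_le_of_le (hb μ _) _).trans (mul_le_mul_of_nonneg_left (hdA' μ ν _) (by positivity))) (by positivity))
  have h4 : ‖ad (((I * η : ℂ)) • A ν x) (covD T U ν (A' μ) x)‖ ≤ 2 * (η * a) * g' :=
    (norm_ad_le_of_le (hb ν x) _).trans (mul_le_mul_of_nonneg_left (hdA' ν μ x) (by positivity))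
  have h5 : ‖ad (((I * η : ℂ)) • A μ x) (covD T U μ (A' ν) x)‖ ≤ 2 * (η * a) * g' :=
    (norm_ad_le_of_le (hb μ x) _).trans (mul_le_mul_of_nonneg_left (hdA' μ ν x) (by positivity))
  have h6 : ‖ad (((I * η : ℂ)) • covDstar T U ν (A μ) x) (R (U ν ((T ν).symm x))⁻¹ (A' ν ((T ν).symm x)))‖
      ≤ 2 * (η * (ρ ^ 2 * g)) * (ρ ^ 2 * a') :=
    (norm_ad_le_of_le (hbd ν μ x) _).trans (mul_le_mul_of_nonneg_left
      ((hRt ν _ _).trans (mul_le_mul_of_nonneg_left (hA' ν _) (by positivity))) (by positivity))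
  have h7 : ‖ad (((I * η : ℂ)) • A μ x) (covDstar T U ν (A' ν) x)‖ ≤ 2 * (η * a) * (ρ ^ 2 * g') :=
    (norm_ad_le_of_le (hb μ x) _).trans (mul_le_mul_of_nonneg_left (hds' ν ν x) (by positivity))
  unfold sBracket
  refine (norm_add_le_of_le (norm_add_le_of_le (norm_sub_le_of_le (norm_add_le_of_le (norm_add_le_of_le
    (norm_sub_le_of_le h1 h2) h3) h4) h5) h6) h7).trans (le_of_eq ?_)
  ring

omit [CompleteSpace 𝔸] in
/-- (3.73) FOR THE FIRST-ORDER PART `Σ_ν sBracket_ν`: `≤ d·η((8ρ² + 4)ag′ + 2ρ²(1 + ρ²)ga′)` (= `4dη(3ag′ + ga′)` at `ρ = 1`: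
`η²·O(1)(|A||∇A′| + |∇A||A′|)` with `g = η|∇A|`, `g′ = η|∇A′|`). [folklore] [cite: Balaban1985BackgroundPropagators, (3.73) p.405] -/
theorem norm_sum_sBracket_le [Fintype ι] {η ρ a a' g g' : ℝ} (hη : 0 ≤ η)
    (hU : ∀ κ z, ‖(U κ z : 𝔸)‖ ≤ ρ) (hU' : ∀ κ z, ‖(((U κ z)⁻¹ : 𝔸ˣ) : 𝔸)‖ ≤ ρ)
    (A A' : ι → S → 𝔸) (hA : ∀ κ z, ‖A κ z‖ ≤ a) (hA' : ∀ κ z, ‖A' κ z‖ ≤ a')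
    (hdA : ∀ κ τ z, ‖covD T U κ (A τ) z‖ ≤ g) (hdA' : ∀ κ τ z, ‖covD T U κ (A' τ) z‖ ≤ g') (μ : ι) (x : S) :
    ‖∑ ν, sBracket T U η A A' ν μ x‖ ≤ Fintype.card ι * (η * ((8 * ρ ^ 2 + 4) * a * g' + 2 * ρ ^ 2 * (1 + ρ ^ 2) * g * a')) := by
  calc _ ≤ ∑ ν, ‖sBracket T U η A A' ν μ x‖ := norm_sum_le _ _
    _ ≤ ∑ _ν : ι, η * ((8 * ρ ^ 2 + 4) * a * g' + 2 * ρ ^ 2 * (1 + ρ ^ 2) * g * a') :=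
        Finset.sum_le_sum fun ν _ => norm_sBracket_le T U hη hU hU' A A' hA hA' hdA hdA' ν μ x
    _ = _ := by simp [Finset.sum_const, Finset.card_univ, nsmul_eq_mul]

/-- **(3.73), FIRST INEQUALITY** — «|(V₁(A)A′)(b)| ≤ O(1)(|A||∇A′| + |∇A||A′| + |A|²|A′|)» — for the print's `V₁(A)A′ = Σ_ν(seven-term
bracket)_ν + F_{1,k}(A)A′`, one direction, uniform sups (`‖A‖ ≤ a`, `‖A′‖ ≤ a′`, `‖D¹A‖ ≤ g`, `‖D¹A′‖ ≤ g′`), transport size `ρ ≥ 1`: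
`‖(V₁(A)A′)_μ(x)‖ ≤ d·[η((8ρ² + 4)ag′ + 2ρ²(1 + ρ²)ga′) + 8ρ⁴s²e^{2s}(3 + 2s + s²e^{2s})a′]`, `s = ηρ²a` — the three printed terms with
`O(1)` explicit (×`η²`: `g = η|∇A|`, `g′ = η|∇A′|`, `s² ∝ η²|A|²`). [folklore] [cite: Balaban1985BackgroundPropagators, (3.73) p.405] -/
theorem norm_V₁op_le [Fintype ι] {η ρ a a' g g' : ℝ} (hη : 0 ≤ η) (hρ : 1 ≤ ρ)
    (hU : ∀ κ z, ‖(U κ z : 𝔸)‖ ≤ ρ) (hU' : ∀ κ z, ‖(((U κ z)⁻¹ : 𝔸ˣ) : 𝔸)‖ ≤ ρ)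
    (A A' : ι → S → 𝔸) (hA : ∀ κ z, ‖A κ z‖ ≤ a) (hA' : ∀ κ z, ‖A' κ z‖ ≤ a')
    (hdA : ∀ κ τ z, ‖covD T U κ (A τ) z‖ ≤ g) (hdA' : ∀ κ τ z, ‖covD T U κ (A' τ) z‖ ≤ g') (μ : ι) (x : S) :
    ‖V₁op T U η A A' μ x‖
      ≤ Fintype.card ι * (η * ((8 * ρ ^ 2 + 4) * a * g' + 2 * ρ ^ 2 * (1 + ρ ^ 2) * g * a')
          + 8 * ρ ^ 4 * (η * ρ ^ 2 * a) ^ 2 * Real.exp (2 * (η * ρ ^ 2 * a))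
            * (3 + 2 * (η * ρ ^ 2 * a) + (η * ρ ^ 2 * a) ^ 2 * Real.exp (2 * (η * ρ ^ 2 * a))) * a') := by
  unfold V₁op
  have h1 := norm_sum_sBracket_le T U hη hU hU' A A' hA hA' hdA hdA' μ x
  have h2 := norm_F₁op_le T U hη hρ hU hU' A A' hA hA' μ x
  exact (norm_add_le_of_le h1 h2).trans (le_of_eq (by ring))

omit [CompleteSpace 𝔸] in
/-- (3.73), SECOND INEQUALITY, FIRST-ORDER PART, AT THE PRINTED SCALE (`ρ = 1`; (3.37) at the letters: `a ≤ α₁(L^jη)⁻¹` and, for the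
exponent field's covariant differences, `g ≤ η·α₁(L^jη)⁻²` = the print's `|∇^η_UA| < α₁(L^jη)⁻²` times the normalisation `D¹ = ηD`):
`‖Σ_ν sBracket_ν‖ ≤ 4d·α₁·(3L^{−j}·g′ + L^{−2j}·a′)`. [folklore] [cite: Balaban1985BackgroundPropagators, (3.73) p.405, (3.37) p.396] -/
theorem norm_sum_sBracket_le_printed [Fintype ι] {η L α₁ a a' g g' : ℝ} {j : ℕ} (hη : 0 < η) (hL : 1 ≤ L)
    (hU : ∀ κ z, ‖(U κ z : 𝔸)‖ ≤ 1) (hU' : ∀ κ z, ‖(((U κ z)⁻¹ : 𝔸ˣ) : 𝔸)‖ ≤ 1)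
    (A A' : ι → S → 𝔸) (hA : ∀ κ z, ‖A κ z‖ ≤ a) (ha : a ≤ α₁ * (L ^ j * η)⁻¹) (hA' : ∀ κ z, ‖A' κ z‖ ≤ a')
    (hdA : ∀ κ τ z, ‖covD T U κ (A τ) z‖ ≤ g) (hg : g ≤ η * (α₁ * ((L ^ j * η)⁻¹) ^ 2))
    (hdA' : ∀ κ τ z, ‖covD T U κ (A' τ) z‖ ≤ g') (μ : ι) (x : S) :
    ‖∑ ν, sBracket T U η A A' ν μ x‖ ≤ Fintype.card ι * (4 * α₁ * (3 * (L ^ j)⁻¹ * g' + ((L ^ j)⁻¹) ^ 2 * a')) := by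
  have h := norm_sum_sBracket_le T U hη.le hU hU' A A' hA hA' hdA hdA' μ x
  have hLj : 1 ≤ L ^ j := one_le_pow₀ hL
  have hLj0 : 0 < L ^ j := lt_of_lt_of_le one_pos hLj
  have ha'0 : 0 ≤ a' := (norm_nonneg _).trans (hA' μ x)
  have hg' : 0 ≤ g' := (norm_nonneg _).trans (hdA' μ μ x)
  have h1 : η * a * g' ≤ α₁ * (L ^ j)⁻¹ * g' := by
    have : η * a ≤ α₁ * (L ^ j)⁻¹ := by
      calc η * a ≤ η * (α₁ * (L ^ j * η)⁻¹) := mul_le_mul_of_nonneg_left ha hη.le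
        _ = α₁ * (L ^ j)⁻¹ := by field_simp
    exact mul_le_mul_of_nonneg_right this hg'
  have h2 : η * g * a' ≤ α₁ * ((L ^ j)⁻¹) ^ 2 * a' := by
    have : η * g ≤ α₁ * ((L ^ j)⁻¹) ^ 2 := by
      calc η * g ≤ η * (η * (α₁ * ((L ^ j * η)⁻¹) ^ 2)) := mul_le_mul_of_nonneg_left hg hη.le
        _ = α₁ * ((L ^ j)⁻¹) ^ 2 := by field_simp
    exact mul_le_mul_of_nonneg_right this ha'0
  refine h.trans (mul_le_mul_of_nonneg_left ?_ (Nat.cast_nonneg _))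
  nlinarith [h1, h2]

/-- **(3.73), SECOND INEQUALITY, AT THE PRINTED SCALE** — «≤ O(1)α₁((L^jη)⁻¹|∇A′| + (L^jη)⁻²|A′|), b ∈ Ω_j» — for the print's `V₁`
(first-order part + `F_{1,k}`), `ρ = 1`, (3.37) at the letters (`a ≤ α₁(L^jη)⁻¹`, `g ≤ η·α₁(L^jη)⁻²`, `L ≥ 1`, `η > 0`):
`‖(V₁(A)A′)_μ(x)‖ ≤ d·α₁·[12·L^{−j}·g′ + (4 + 8α₁e^{2α₁}(3 + 2α₁ + α₁²e^{2α₁}))·L^{−2j}·a′]` — `η²` times the printed right side with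
`O(1)` explicit (`g′ = η|∇A′|`; «an absolute constant depending on d only» once `α₁ ≤ 1`). [folklore]
[cite: Balaban1985BackgroundPropagators, (3.73) p.405, (3.37) p.396] -/
theorem norm_V₁op_le_printed [Fintype ι] {η L α₁ a a' g g' : ℝ} {j : ℕ} (hη : 0 < η) (hL : 1 ≤ L)
    (hU : ∀ κ z, ‖(U κ z : 𝔸)‖ ≤ 1) (hU' : ∀ κ z, ‖(((U κ z)⁻¹ : 𝔸ˣ) : 𝔸)‖ ≤ 1)
    (A A' : ι → S → 𝔸) (hA : ∀ κ z, ‖A κ z‖ ≤ a) (ha : a ≤ α₁ * (L ^ j * η)⁻¹) (hA' : ∀ κ z, ‖A' κ z‖ ≤ a')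
    (hdA : ∀ κ τ z, ‖covD T U κ (A τ) z‖ ≤ g) (hg : g ≤ η * (α₁ * ((L ^ j * η)⁻¹) ^ 2))
    (hdA' : ∀ κ τ z, ‖covD T U κ (A' τ) z‖ ≤ g') (μ : ι) (x : S) :
    ‖V₁op T U η A A' μ x‖
      ≤ Fintype.card ι * (α₁ * (12 * (L ^ j)⁻¹ * g'
          + (4 + 8 * α₁ * Real.exp (2 * α₁) * (3 + 2 * α₁ + α₁ ^ 2 * Real.exp (2 * α₁))) * ((L ^ j)⁻¹) ^ 2 * a')) := by
  unfold V₁op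
  have h1 := norm_sum_sBracket_le_printed T U hη hL hU hU' A A' hA ha hA' hdA hg hdA' μ x
  have h2 := norm_F₁op_le_printed T U hη hL hU hU' A A' hA ha hA' μ x
  exact (norm_add_le_of_le h1 h2).trans (le_of_eq (by ring))

end Bounds

/-! ## §5  Sanity -/

section Examples

variable {𝔸 : Type*} [NormedRing 𝔸] [NormedAlgebra ℂ 𝔸] [CompleteSpace 𝔸] {S : Type*} {ι : Type*}
variable (T : ι → Equiv.Perm S) (U : ι → S → 𝔸ˣ)

/-- No fluctuation field, no correction: at `A = 0` both brackets and the higher-order terms vanish … -/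
example (η : ℝ) (A' : ι → S → 𝔸) (ν μ : ι) (x : S) : sBracket T U η 0 A' ν μ x = 0 := by
  simp [sBracket, covDstar]

example (η : ℝ) (A' : ι → S → 𝔸) (ν μ : ι) (x : S) : fRem T U η 0 A' ν μ x = 0 := by
  simp [fRem, curlE₁, curlE₂, conjRem, covDstar]

example [Fintype ι] (η : ℝ) (A' : ι → S → 𝔸) (μ : ι) (x : S) : V₁op T U η 0 A' μ x = 0 := by
  simp [V₁op, F₁op, sBracket, fRem, curlE₁, curlE₂, conjRem, covDstar]

/-- … consistently with `prodCfg U η 0 = U` (`B9Eq369Product.prodCfg_zero`) in (3.71). -/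
example [Fintype ι] (η : ℝ) (A' : ι → S → 𝔸) (μ : ι) (x : S) : lapDD T (prodCfg U η 0) A' μ x = lapDD T U A' μ x := by
  rw [prodCfg_zero]

/-- Over a commutative carrier the first-order operator vanishes identically (`V₁` is a sum of commutators). -/
example {𝔹 : Type*} [NormedCommRing 𝔹] [NormedAlgebra ℂ 𝔹] (T : ι → Equiv.Perm S) (U : ι → S → 𝔹ˣ) (η : ℝ)
    (A A' : ι → S → 𝔹) (ν μ : ι) (x : S) : sBracket T U η A A' ν μ x = 0 := by
  simp [sBracket, mul_comm]

end Examples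

end Literature.MathematicalPhysics.QuantumFieldTheory.Balaban1983to89.B9Eq371Composition

end
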